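import Summits.QuantumFields.BalabanUV.Beta.SymmetrisedAxialGaugeBlockMean
import Summits.QuantumFields.BalabanUV.Beta.AxialDressingRootedBmKernel

/-!
# `BalabanUV.Beta.SymmetrisedDressingMatrix` — binder row D1, JSB12SYM-SPINE v1.1 (Σ2) step K1-a part 1: THE MATRIX OF THE SYMMETRISED
# BLOCK-MEAN AXIAL PROJECTOR `pmSymBm ρ N β p α q := (Π^{sym}_bm δ_{(α,q)})_β(p)` — SUPPORT (the window `p − q ∈ cube`), BOUND, block-translation
# covariance, and its PERMUTATION covariance at the centred root (cf. the comb's `AxialDressingRootedBm.pmBm`, which has none)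

HONEST FRAMING (cell contract, verbatim): «discharging `BetaPertH` makes Bałaban's UV stability UNCONDITIONAL — a real constructive-QFT
result; it is NOT the continuum limit and NOT the Clay problem.»  THIS MODULE DISCHARGES NOTHING of `BetaPertH` ∕ row D1: [folklore] finite sums
on `ℤ^n` (Form level, entries of OUR projector).  0 sorry, 0 `def … : Prop`, nothing cited; quotations are OBJECT LOCATORS.

WHAT.  The dressing of the re-based literal «JsB12Sym» (RULING R-D1-g25-1; memo JSB12SYM-SPINE v1.1 (Σ2)) co-dresses the packed resolvents by the
kernelisation `piKSymBm` of S1f's `symAxProjBmAt` (next file, pattern `AxialDressingRootedBmKernel.piKBm`).  This file is its matrix and the three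
facts the kernel packing needs: (i) SUPPORT — `symTreeGaugeAt (toSite r) (δ_{(a,q)}) N p ≠ 0` forces the bond `(a,q)` into the block of `p` (every σ-comb
from the root of `B(blk p)` to `p` stays in that block: the comb's `treeGaugeAt_bondInd_ne_zero_blk` transported along `P1 σ`), hence
`pmSymBm (toSite r) N β p α q ≠ 0 → p − q ∈ cube n N`; (ii) BOUND `|pmSymBm| ≤ 1 + 4·n·N` (the symmetrised tree integral of an indicator is `≤ n!·n·N`,
`abs_treeGaugeAt_bondInd_le` per order, then the `1∕n!`); (iii) BLOCK TRANSLATION `pmSymBm ρ N β (p + N•z) α (q + N•z) = pmSymBm ρ N β p α q`; and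
(iv) **`pmSymBm_perm : pmSymBm (ctr n N) N (σ β) (σ•p) (σ α) (σ•q) = pmSymBm (ctr n N) N β p α q`** (S1f `symAxProjBmAt_ctr_P1`).
NOT HERE: the `MKer` packing, `Spr`, `shiftK`∕`refK`∕`permK` at kernel level (K1-a part 2), the slice projector `symE` (K1-b).
NOT D1, NOT BetaPertH, NOT continuum, NOT Clay.
CHART (RULING R-D1-g25-4): chart (II) — the FIXED κ = 0 slice `ker G_sym` with the block-orthogonal `symE`; the slice-exchange row hSX
(`R_SX`, an3-g46 THEOREM R, `b2b-balaban-beta-an3/gen46/FP-SYM.v1.md`) is a SEPARATE displayed binder of the literal and is NOT in this file.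
HONEST DEPENDENCY (verbatim): «continuum YM on T⁴ ⇐ BetaPertH ∧ nine spine estimates (0/9 proved); BetaPertH ⇐ (D1) ∧ (D4) ∧ CAP+tail;
G-an2-4 gates asym, D1 and NE2/3/4.»  ABSOLUTE RULE (cell, verbatim): «No internally-minted statement may enter as a cited fact. Every
hypothesis is either kernel-proved in this package or a verbatim quotation of a PUBLISHED theorem with page reference.»
Unit `b2b-balaban-beta-an2` gen 25 (row-D1 owner), 2026-08-21.
-/

namespace Summit.QuantumFields.BalabanUV.Beta.SymmetrisedDressingMatrix

noncomputable section

open Finset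
open scoped BigOperators Nat
open Literature.MathematicalPhysics.QuantumFieldTheory
open Literature.MathematicalPhysics.QuantumFieldTheory.Balaban1983to89
open Literature.MathematicalPhysics.QuantumFieldTheory.Balaban1983to89.Beta
open AffineAveraging (Form0 Form1 Site unitVec unitVec_apply box toSite blockSum)
open AveragingContours (blk grad shift blk_block)
open AveragingContoursRooted (treeGaugeAt ctr ctrOff ctrOff_mem_box)
open AxialProjector (zsmul_blk_le lt_zsmul_blk_add blk_add_zsmul)
open Summit.QuantumFields.BalabanUV.Beta.KernelPermutation (psite psite_apply psite_symm_apply psite_add psite_smul psite_symm_apply_eq)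
open Summit.QuantumFields.BalabanUV.Beta.ResolventPermutation (P0 P1 P0_apply P1_apply psite_mem_box toSite_psite psite_unitVec)
open Summit.QuantumFields.BalabanUV.Beta.AxialDressingRooted (bondInd bondInd_apply abs_treeGaugeAt_bondInd_le cube mem_cube
  treeGaugeAt_bondInd_ne_zero_blk treeGaugeAt_map)
open Summit.QuantumFields.BalabanUV.Beta.AxialProjectorBlockMean (blockMeanAt)
open Summit.QuantumFields.BalabanUV.Beta.SymmetrisedAxialPotential
open Summit.QuantumFields.BalabanUV.Beta.SymmetrisedAxialGauge
open Summit.QuantumFields.BalabanUV.Beta.SymmetrisedAxialGaugeBlockMean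

variable {n : ℕ}

/-! ## §1 Bond indicators under the axis permutation; the symmetrised tree integral of an indicator -/

/-- [our object] The real-valued indicator one-form of the bond `(α, q)` (= the comb files' `bondInd` cast to `ℝ`). -/
def bondIndR (α : Fin n) (q : Fin n → ℤ) : Form1 n ℝ := fun κ z => (bondInd α q κ z : ℝ)

/-- [folklore] Pointwise form. -/
theorem bondIndR_apply (α : Fin n) (q : Fin n → ℤ) (κ : Fin n) (z : Fin n → ℤ) :
    bondIndR α q κ z = if κ = α ∧ z = q then 1 else 0 := by
  simp only [bondIndR, bondInd_apply]; split <;> simp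

/-- [folklore] **The pull-back of a bond indicator is the indicator of the pulled-back bond**: `P1 σ δ_{(α,q)} = δ_{(σ⁻¹α, σ⁻¹•q)}`. -/
theorem P1_bondIndR (σ : Equiv.Perm (Fin n)) (α : Fin n) (q : Fin n → ℤ) :
    P1 σ (bondIndR α q) = bondIndR (σ.symm α) ((psite σ).symm q) := by
  funext κ z
  simp only [P1_apply, bondIndR_apply, Equiv.apply_eq_iff_eq_symm_apply]

/-- [folklore] The real tree integral of a real indicator is the cast of the integer one. -/
theorem treeGaugeAt_bondIndR (ρ : Fin n → ℤ) (α : Fin n) (q : Fin n → ℤ) (N : ℕ) (x : Fin n → ℤ) :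
    treeGaugeAt ρ (bondIndR α q) N x = ((treeGaugeAt ρ (bondInd α q) N x : ℤ) : ℝ) :=
  treeGaugeAt_map (Int.castAddHom ℝ) ρ (bondInd α q) N x

/-- [folklore] The pulled-back root offset stays in the box, as a site. -/
theorem psite_symm_toSite (σ : Equiv.Perm (Fin n)) (r : Fin n → ℕ) : (psite σ).symm (toSite r) = toSite ((psite σ).symm r) := rfl

/-- [folklore] The pulled-back box offset is a box offset. -/
theorem psite_symm_mem_box (σ : Equiv.Perm (Fin n)) {N : ℕ} {r : Fin n → ℕ} (hr : r ∈ box n N) : (psite σ).symm r ∈ box n N := by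
  rw [psite_symm_apply_eq]; exact psite_mem_box σ⁻¹ hr

/-- [folklore] **BOUND**: the symmetrised tree integral of a bond indicator is at most `n!·(n·N)` in absolute value (in-block root). -/
theorem abs_symTreeGaugeAt_bondIndR_le {N : ℕ} (hN : 1 ≤ N) {r : Fin n → ℕ} (hr : r ∈ box n N) (α : Fin n) (q x : Fin n → ℤ) :
    |symTreeGaugeAt (toSite r) (bondIndR α q) N x| ≤ (n ! : ℝ) * ((n : ℝ) * N) := by
  rw [symTreeGaugeAt_eq_sum]
  refine (Finset.abs_sum_le_sum_abs _ _).trans ?_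
  have hterm : ∀ σ ∈ (Finset.univ : Finset (Equiv.Perm (Fin n))),
      |treeGaugeAt ((psite σ).symm (toSite r)) (P1 σ (bondIndR α q)) N ((psite σ).symm x)| ≤ (n : ℝ) * N := by
    intro σ _
    rw [P1_bondIndR, psite_symm_toSite, treeGaugeAt_bondIndR]
    have h := abs_treeGaugeAt_bondInd_le hN (psite_symm_mem_box σ hr) (σ.symm α) ((psite σ).symm q) ((psite σ).symm x)
    have h' : ((|treeGaugeAt (toSite ((psite σ).symm r)) (bondInd (σ.symm α) ((psite σ).symm q)) N ((psite σ).symm x)| : ℤ) : ℝ)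
        ≤ (((n : ℤ) * N : ℤ) : ℝ) := by exact_mod_cast h
    rw [Int.cast_abs] at h'
    push_cast at h'
    exact h'
  refine (Finset.sum_le_sum hterm).trans ?_
  rw [Finset.sum_const, Finset.card_univ, card_perm_fin, nsmul_eq_mul]

/-- [folklore] From coordinate bounds to the block index. -/
theorem blk_eq_of_bounds {N : ℕ} (hN : 1 ≤ N) {q y : Fin n → ℤ} (h : ∀ j, ((N : ℤ) • y) j ≤ q j ∧ q j ≤ ((N : ℤ) • y) j + N - 1) : blk N q = y := by
  funext j
  obtain ⟨h1, h2⟩ := h j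
  simp only [Pi.smul_apply, smul_eq_mul] at h1 h2
  show q j / (N : ℤ) = y j
  have hN' : (0 : ℤ) < N := by exact_mod_cast hN
  have e : q j = (q j - N * y j) + y j * N := by ring
  rw [e, Int.add_mul_ediv_right _ _ hN'.ne', Int.ediv_eq_zero_of_lt (by linarith) (by linarith), zero_add]

/-- [folklore] **SUPPORT**: if the symmetrised tree integral of `δ_{(a,q)}` at `p` is non-zero, the bond `(a, q)` lies in the block of `p` (both endpoints). -/
theorem symTreeGaugeAt_bondIndR_ne_zero_blk {N : ℕ} (hN : 1 ≤ N) {r : Fin n → ℕ} (hr : r ∈ box n N) {a : Fin n} {q p : Fin n → ℤ}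
    (h : symTreeGaugeAt (toSite r) (bondIndR a q) N p ≠ 0) : blk N q = blk N p ∧ blk N (q + unitVec a) = blk N p := by
  rw [symTreeGaugeAt_eq_sum] at h
  obtain ⟨σ, -, hσ⟩ := Finset.exists_ne_zero_of_sum_ne_zero h
  rw [P1_bondIndR, psite_symm_toSite, treeGaugeAt_bondIndR, Int.cast_ne_zero] at hσ
  have hb := treeGaugeAt_bondInd_ne_zero_blk hN (psite_symm_mem_box σ hr) hσ
  have h1 : blk N ((psite σ).symm q) = blk N ((psite σ).symm p) :=
    blk_eq_of_bounds hN fun j => ⟨(hb j).1, (hb j).2.1⟩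
  have h2 : blk N ((psite σ).symm q + unitVec (σ.symm a)) = blk N ((psite σ).symm p) :=
    blk_eq_of_bounds hN fun j => by
      have h3 := (hb j).2.2
      simp only [Pi.add_apply, unitVec_apply] at h3 ⊢
      exact h3
  constructor
  · have e := congrArg (psite σ) h1
    rwa [← blk_psite, ← blk_psite, Equiv.apply_symm_apply, Equiv.apply_symm_apply] at e
  · have e := congrArg (psite σ) h2
    rwa [← blk_psite, ← blk_psite, psite_add, Equiv.apply_symm_apply, Equiv.apply_symm_apply, ← psite_symm_unitVec,
      Equiv.apply_symm_apply] at e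

/-! ## §2 The matrix `pmSymBm` of `Π^{sym}_bm`: formula, window, bound -/

/-- [our object] **THE MATRIX OF THE SYMMETRISED BLOCK-MEAN PROJECTOR**: `pmSymBm ρ N β p α q := (Π^{sym}_bm δ_{(α,q)})_β(p)` (cf. `AxialDressingRootedBm.pmBm`). -/
def pmSymBm (ρ : Fin n → ℤ) (N : ℕ) (β : Fin n) (p : Fin n → ℤ) (α : Fin n) (q : Fin n → ℤ) : ℝ :=
  symAxProjBmAt ρ N (bondIndR α q) β p

/-- [folklore] THE FORMULA: `pmSymBm = δ − (g(p + e_β) − g(p)) + (bm g (p + e_β) − bm g (p))`, `g = (n!)⁻¹·symTreeGaugeAt ρ δ_{(α,q)}`. -/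
theorem pmSymBm_eq (ρ : Fin n → ℤ) (N : ℕ) (β : Fin n) (p : Fin n → ℤ) (α : Fin n) (q : Fin n → ℤ) :
    pmSymBm ρ N β p α q = bondIndR α q β p
      - (symGaugeAt ρ (bondIndR α q) N (p + unitVec β) - symGaugeAt ρ (bondIndR α q) N p)
      + (blockMeanAt N (symGaugeAt ρ (bondIndR α q) N) (p + unitVec β) - blockMeanAt N (symGaugeAt ρ (bondIndR α q) N) p) := by
  simp only [pmSymBm, symAxProjBmAt, symBmGaugeAt, Pi.sub_apply, grad]
  ring

/-- [folklore] If the normalised symmetrised tree integral of `δ_{(α,q)}` is non-zero at `x`, the bond lies in the block of `x`. -/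
theorem symGaugeAt_bondIndR_ne_zero_blk {N : ℕ} (hN : 1 ≤ N) {r : Fin n → ℕ} (hr : r ∈ box n N) {α : Fin n} {q x : Fin n → ℤ}
    (h : symGaugeAt (toSite r) (bondIndR α q) N x ≠ 0) : blk N q = blk N x ∧ blk N (q + unitVec α) = blk N x := by
  apply symTreeGaugeAt_bondIndR_ne_zero_blk hN hr
  intro h0
  exact h (by rw [symGaugeAt, h0, mul_zero])

/-- [folklore] If the block mean of that function is non-zero at `x`, the bond lies in the block of `x`. -/
theorem blockMeanAt_symGaugeAt_bondIndR_ne_zero_blk {N : ℕ} (hN : 1 ≤ N) {r : Fin n → ℕ} (hr : r ∈ box n N) {α : Fin n}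
    {q x : Fin n → ℤ} (h : blockMeanAt N (symGaugeAt (toSite r) (bondIndR α q) N) x ≠ 0) :
    blk N q = blk N x ∧ blk N (q + unitVec α) = blk N x := by
  unfold blockMeanAt at h
  have h' : blockSum N (symGaugeAt (toSite r) (bondIndR α q) N) (blk N x) ≠ 0 := fun h0 => h (by rw [h0, zero_div])
  unfold blockSum at h'
  obtain ⟨b, hb, hb0⟩ := Finset.exists_ne_zero_of_sum_ne_zero h'
  have h2 := symGaugeAt_bondIndR_ne_zero_blk hN hr hb0
  rwa [blk_block (blk N x) hb] at h2

/-- [folklore] Two points of one block differ by a vector of the window. -/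
theorem sub_mem_cube_of_blk_eq {N : ℕ} (hN : 1 ≤ N) {p q : Fin n → ℤ} (h : blk N q = blk N p) : p - q ∈ cube n N := by
  rw [mem_cube]
  intro i
  have a1 := zsmul_blk_le hN p i
  have a2 := lt_zsmul_blk_add hN p i
  have b1 := zsmul_blk_le hN q i
  have b2 := lt_zsmul_blk_add hN q i
  rw [h] at b1 b2
  rw [Pi.sub_apply, abs_le]
  constructor <;> omega

/-- [folklore] … also when the block of `q` is that of `p + e_β`. -/
theorem sub_mem_cube_of_blk_eq_succ {N : ℕ} (hN : 1 ≤ N) {p q : Fin n → ℤ} {β : Fin n} (h : blk N q = blk N (p + unitVec β)) :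
    p - q ∈ cube n N := by
  rw [mem_cube]
  intro i
  have a1 := zsmul_blk_le hN (p + unitVec β) i
  have a2 := lt_zsmul_blk_add hN (p + unitVec β) i
  have b1 := zsmul_blk_le hN q i
  have b2 := lt_zsmul_blk_add hN q i
  rw [h] at b1 b2
  simp only [Pi.add_apply, unitVec_apply] at a1 a2
  rw [Pi.sub_apply, abs_le]
  constructor <;> split_ifs at a1 a2 <;> omega

/-- [folklore] **THE WINDOW**: `pmSymBm (toSite r) N β p α q ≠ 0 → p − q ∈ cube n N` (in-block root, `N ≥ 1`). -/
theorem window_of_pmSymBm_ne_zero {N : ℕ} (hN : 1 ≤ N) {r : Fin n → ℕ} (hr : r ∈ box n N) {β : Fin n} {p : Fin n → ℤ} {α : Fin n}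
    {q : Fin n → ℤ} (h : pmSymBm (toSite r) N β p α q ≠ 0) : p - q ∈ cube n N := by
  rw [pmSymBm_eq] at h
  by_contra hw
  apply h
  have h0 : bondIndR α q β p = 0 := by
    rw [bondIndR_apply, if_neg]
    rintro ⟨-, rfl⟩
    exact hw (by rw [sub_self]; exact AxialDressingRooted.zero_mem_cube N)
  have g1 : symGaugeAt (toSite r) (bondIndR α q) N (p + unitVec β) = 0 := by
    by_contra h1; exact hw (sub_mem_cube_of_blk_eq_succ hN (symGaugeAt_bondIndR_ne_zero_blk hN hr h1).1)
  have g2 : symGaugeAt (toSite r) (bondIndR α q) N p = 0 := by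
    by_contra h1; exact hw (sub_mem_cube_of_blk_eq hN (symGaugeAt_bondIndR_ne_zero_blk hN hr h1).1)
  have g3 : blockMeanAt N (symGaugeAt (toSite r) (bondIndR α q) N) (p + unitVec β) = 0 := by
    by_contra h1; exact hw (sub_mem_cube_of_blk_eq_succ hN (blockMeanAt_symGaugeAt_bondIndR_ne_zero_blk hN hr h1).1)
  have g4 : blockMeanAt N (symGaugeAt (toSite r) (bondIndR α q) N) p = 0 := by
    by_contra h1; exact hw (sub_mem_cube_of_blk_eq hN (blockMeanAt_symGaugeAt_bondIndR_ne_zero_blk hN hr h1).1)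
  rw [h0, g1, g2, g3, g4]; ring

/-- [folklore] The normalised symmetrised tree integral of an indicator is at most `n·N`. -/
theorem abs_symGaugeAt_bondIndR_le {N : ℕ} (hN : 1 ≤ N) {r : Fin n → ℕ} (hr : r ∈ box n N) (α : Fin n) (q x : Fin n → ℤ) :
    |symGaugeAt (toSite r) (bondIndR α q) N x| ≤ (n : ℝ) * N := by
  rw [symGaugeAt, abs_mul, abs_inv, Nat.abs_cast]
  have hf : (0 : ℝ) < n ! := by exact_mod_cast Nat.factorial_pos n
  rw [inv_mul_le_iff₀ hf]
  exact abs_symTreeGaugeAt_bondIndR_le hN hr α q x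

/-- [folklore] … and so is its block mean. -/
theorem abs_blockMeanAt_symGaugeAt_bondIndR_le {N : ℕ} (hN : 1 ≤ N) {r : Fin n → ℕ} (hr : r ∈ box n N) (α : Fin n) (q x : Fin n → ℤ) :
    |blockMeanAt N (symGaugeAt (toSite r) (bondIndR α q) N) x| ≤ (n : ℝ) * N := by
  unfold blockMeanAt
  have hNn : (0 : ℝ) < (N : ℝ) ^ n := pow_pos (by exact_mod_cast hN) _
  rw [abs_div, abs_of_pos hNn, div_le_iff₀ hNn]
  have hcard : (box n N).card = N ^ n := by
    simp only [AffineAveraging.box, Fintype.card_piFinset, Finset.card_range, Finset.prod_const, Finset.card_univ, Fintype.card_fin]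
  unfold blockSum
  refine (Finset.abs_sum_le_sum_abs _ _).trans ?_
  refine (Finset.sum_le_sum fun b _ => abs_symGaugeAt_bondIndR_le hN hr α q ((N : ℤ) • blk N x + toSite b)).trans ?_
  rw [Finset.sum_const, hcard, nsmul_eq_mul]
  push_cast
  ring_nf
  exact le_rfl

/-- [folklore] **THE BOUND**: `|pmSymBm (toSite r) N β p α q| ≤ 1 + 4·n·N` (in-block root). -/
theorem abs_pmSymBm_le {N : ℕ} (hN : 1 ≤ N) {r : Fin n → ℕ} (hr : r ∈ box n N) (β : Fin n) (p : Fin n → ℤ) (α : Fin n)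
    (q : Fin n → ℤ) : |pmSymBm (toSite r) N β p α q| ≤ 1 + 4 * ((n : ℝ) * N) := by
  rw [pmSymBm_eq]
  have h0 : |bondIndR α q β p| ≤ 1 := by rw [bondIndR_apply]; split <;> simp
  have h1 := abs_symGaugeAt_bondIndR_le hN hr α q (p + unitVec β)
  have h2 := abs_symGaugeAt_bondIndR_le hN hr α q p
  have h3 := abs_blockMeanAt_symGaugeAt_bondIndR_le hN hr α q (p + unitVec β)
  have h4 := abs_blockMeanAt_symGaugeAt_bondIndR_le hN hr α q p
  calc |bondIndR α q β p - (symGaugeAt (toSite r) (bondIndR α q) N (p + unitVec β) - symGaugeAt (toSite r) (bondIndR α q) N p)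
        + (blockMeanAt N (symGaugeAt (toSite r) (bondIndR α q) N) (p + unitVec β) - blockMeanAt N (symGaugeAt (toSite r) (bondIndR α q) N) p)|
      ≤ |bondIndR α q β p| + (|symGaugeAt (toSite r) (bondIndR α q) N (p + unitVec β)| + |symGaugeAt (toSite r) (bondIndR α q) N p|)
        + (|blockMeanAt N (symGaugeAt (toSite r) (bondIndR α q) N) (p + unitVec β)| + |blockMeanAt N (symGaugeAt (toSite r) (bondIndR α q) N) p|) := by
        refine (abs_add_le _ _).trans (add_le_add ((abs_sub _ _).trans (add_le_add le_rfl (abs_sub _ _))) (abs_sub _ _))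
    _ ≤ 1 + (((n : ℝ) * N) + ((n : ℝ) * N)) + (((n : ℝ) * N) + ((n : ℝ) * N)) := add_le_add (add_le_add h0 (add_le_add h1 h2)) (add_le_add h3 h4)
    _ = 1 + 4 * ((n : ℝ) * N) := by ring

/-! ## §3 Block translation and permutation covariance of the matrix -/

/-- [folklore] Indicators translate: `δ_{(α, q + w)} = shift (−w) δ_{(α,q)}`. -/
theorem bondIndR_shift (α : Fin n) (q w : Fin n → ℤ) : bondIndR α (q + w) = shift (-w) (bondIndR α q) := by
  funext κ z
  simp only [bondIndR_apply, shift]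
  congr 1
  apply propext
  constructor
  · rintro ⟨h1, rfl⟩; exact ⟨h1, by abel⟩
  · rintro ⟨h1, h2⟩; exact ⟨h1, by rw [← h2]; abel⟩

/-- [folklore] The symmetrised tree gauge is block-translation covariant: `symTreeGaugeAt ρ (shift (N•v) A) N x = symTreeGaugeAt ρ A N (x + N•v)`. -/
theorem symTreeGaugeAt_shift (ρ : Fin n → ℤ) {N : ℕ} (hN : 1 ≤ N) (A : Form1 n ℝ) (x v : Fin n → ℤ) :
    symTreeGaugeAt ρ (shift ((N : ℤ) • v) A) N x = symTreeGaugeAt ρ A N (x + (N : ℤ) • v) := by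
  rw [symTreeGaugeAt, symTreeGaugeAt, blk_add_zsmul hN, ← symAxial_add]
  congr 1
  rw [smul_add]; abel

/-- [folklore] … hence so is the normalised parameter, its block mean, and the projector:
`Π^{sym}_bm (shift (N•v) A) β p = Π^{sym}_bm A β (p + N•v)`. -/
theorem symAxProjBmAt_shift (ρ : Fin n → ℤ) {N : ℕ} (hN : 1 ≤ N) (A : Form1 n ℝ) (v : Fin n → ℤ) (β : Fin n) (p : Fin n → ℤ) :
    symAxProjBmAt ρ N (shift ((N : ℤ) • v) A) β p = symAxProjBmAt ρ N A β (p + (N : ℤ) • v) := by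
  have hg : ∀ x, symGaugeAt ρ (shift ((N : ℤ) • v) A) N x = symGaugeAt ρ A N (x + (N : ℤ) • v) := by
    intro x; rw [symGaugeAt, symGaugeAt, symTreeGaugeAt_shift ρ hN]
  have hbm : ∀ x, blockMeanAt N (symGaugeAt ρ (shift ((N : ℤ) • v) A) N) x = blockMeanAt N (symGaugeAt ρ A N) (x + (N : ℤ) • v) := by
    intro x
    unfold blockMeanAt blockSum
    rw [blk_add_zsmul hN]
    congr 1
    refine Finset.sum_congr rfl fun b _ => ?_
    rw [hg]
    congr 1
    rw [smul_add]; abel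
  simp only [symAxProjBmAt, symBmGaugeAt, Pi.sub_apply, grad, shift, hg, hbm]
  have e : p + unitVec β + (N : ℤ) • v = p + (N : ℤ) • v + unitVec β := by abel
  rw [e]

/-- [folklore] **BLOCK TRANSLATION OF THE MATRIX**: `pmSymBm ρ N β (p + N•z) α (q + N•z) = pmSymBm ρ N β p α q` (cf. `pmBm_shift`). -/
theorem pmSymBm_shift (ρ : Fin n → ℤ) {N : ℕ} (hN : 1 ≤ N) (β : Fin n) (p : Fin n → ℤ) (α : Fin n) (q z : Fin n → ℤ) :
    pmSymBm ρ N β (p + (N : ℤ) • z) α (q + (N : ℤ) • z) = pmSymBm ρ N β p α q := by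
  have hneg : -((N : ℤ) • z) = (N : ℤ) • (-z) := by rw [smul_neg]
  rw [pmSymBm, pmSymBm, bondIndR_shift, hneg, symAxProjBmAt_shift ρ hN]
  congr 1
  rw [smul_neg]; abel

/-- [folklore] **PERMUTATION COVARIANCE OF THE MATRIX** at the centred root: `pmSymBm ρ_c N (σ β) (σ•p) (σ α) (σ•q) = pmSymBm ρ_c N β p α q` — the property the
comb's `pmBm` lacks (S1f `symAxProjBmAt_ctr_P1`). -/
theorem pmSymBm_perm (σ : Equiv.Perm (Fin n)) (N : ℕ) (β : Fin n) (p : Fin n → ℤ) (α : Fin n) (q : Fin n → ℤ) :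
    pmSymBm (ctr n N) N (σ β) (psite σ p) (σ α) (psite σ q) = pmSymBm (ctr n N) N β p α q := by
  have hb : bondIndR (σ α) (psite σ q) = P1 σ⁻¹ (bondIndR α q) := by
    rw [P1_bondIndR]; rfl
  rw [pmSymBm, pmSymBm, hb, symAxProjBmAt_ctr_P1, P1_apply, KernelPermutation.psite_inv_psite]
  have e : σ⁻¹ (σ β) = β := σ.symm_apply_apply β
  rw [e]

end

end Summit.QuantumFields.BalabanUV.Beta.SymmetrisedDressingMatrix
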